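import Literature.Geometry.Lorentzian.ModelData
import Literature.Geometry.Lorentzian.CauchyProblemProofs
import Literature.Geometry.Lorentzian.LeviCivitaProofs
import Literature.Geometry.Lorentzian.GeodesicProofs
import HarnessLib

/-!
# Minkowski spacetime has complete future null infinity: discharge of
`Literature.Geometry.Lorentzian.minkowski_hasCompleteFutureNullInfinity`

Sibling proof file of `ModelData.lean` (D-0014: the named fact
`def minkowski_hasCompleteFutureNullInfinity [Minkowski.DevelopmentFacts] : Prop` — the sanity
statement "the Minkowski development of the trivial data has complete future null infinity in
Christodoulou's intrinsic (sojourn) sense", Christodoulou, CQG 16 (1999) A23, p. A27;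
Dafermos–Rodnianski, arXiv:0811.0354, §2.6.2 — is discharged here as
`theorem minkowski_hasCompleteFutureNullInfinity_holds`, sorry-free).

## Status of the statement (read first)

The fact is stated under the instance hypothesis `[Minkowski.DevelopmentFacts]`, which the tree has
meanwhile shown to be **uninhabited** (`Minkowski.not_developmentFacts`,
`MinkowskiCauchyDefect.lean`: its field `isCauchySurface_range_sliceEmbed` is false as declared), so
the named fact is vacuous as a hypothesis. The proof below does **not** use this: it is the genuine
argument, valid for any instance of the class, and is literally the one the tree already runs for
the corrected, non-vacuous Cauchy-development form
(`hasCompleteNullInfinity_of_toSpacetime_eq_minkowski`,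
`Summits/FinalStateConjecture/…/ExactKerrEndsCensorshipAlongKerrEndsMinkowskiCensored.lean`, which a
`Literature` file may not import). Recording it here closes the D-0014 debt entry of `ModelData.lean`
with a proof rather than leaving a vacuous fact open; nothing downstream changes.

## The printed argument and its formalisation

Christodoulou (1999), p. A27: Minkowski space has complete future null infinity because it is
null geodesically complete — every affinely parametrised null geodesic is a straight line, defined
on all of `ℝ` (O'Neill 1983, Ch. 3, Example 25), so every normalised future null ray from the data
hypersurface has affine domain unbounded above, which is the first disjunct of the sojourn
alternative (with `B₀ = B₁ = ∅`). In the tree: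

* `Minkowski.development.toDevelopment` has carrier `E4`, metric `Minkowski.smoothMetric = η`,
  embedding `Minkowski.sliceEmbed` and normal `Minkowski.sliceNormal` (all by `rfl`);
* `Minkowski.isGeodesicallyComplete_smoothMetric` (`CauchyProblemProofs.lean`): `η` is geodesically
  complete (straight lines);
* `LorentzianMetric.hasCompleteFutureNullInfinity_of_isNullGeodesicallyComplete`
  (`NullInfinity.lean`): null geodesic completeness implies complete future null infinity w.r.t.
  any data hypersurface, given uniqueness of maximal geodesics
  (`IsGeodesicOn.eqOn_of_velocity_eq_holds`, `GeodesicProofs.lean`) and a `C¹` Levi-Civita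
  connection (`PseudoRiemannianMetric.isLocallyContMDiff_leviCivita_holds`, `LeviCivitaProofs.lean`).

## References

* D. Christodoulou, *On the global initial value problem and the issue of singularities*,
  Class. Quantum Grav. 16 (1999) A23–A35, p. A27. [cite: Christodoulou1999, p. A27]
* M. Dafermos, I. Rodnianski, *Lectures on black holes and linear waves*, arXiv:0811.0354, §2.6.2.
  [cite: arXiv08110354, §2.6.2]
* B. O'Neill, *Semi-Riemannian Geometry*, Academic Press (1983), Ch. 3, Example 25 (p. 69).

## Design notes

No definition, notation or instance is introduced; the class hypothesis of the fact is taken as a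
section variable, so the discharge is literally `theorem minkowski_hasCompleteFutureNullInfinity_holds :
minkowski_hasCompleteFutureNullInfinity`.
-/

open scoped Manifold ContDiff
open Set

namespace Literature.Geometry.Lorentzian

section Discharge

variable [Minkowski.DevelopmentFacts]

/-- **Minkowski spacetime has complete future null infinity** (Christodoulou, CQG 16 (1999),
p. A27; Dafermos–Rodnianski, arXiv:0811.0354, §2.6.2): discharge of the named fact
`Literature.Geometry.Lorentzian.minkowski_hasCompleteFutureNullInfinity` of `ModelData.lean`. The
metric of the Minkowski development is `η` (by `rfl`), which is geodesically complete
(`Minkowski.isGeodesicallyComplete_smoothMetric`), so every normalised null ray from `{t = 0}` is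
defined on all of `ℝ` (`LorentzianMetric.hasCompleteFutureNullInfinity_of_isNullGeodesicallyComplete`,
with uniqueness of geodesics `IsGeodesicOn.eqOn_of_velocity_eq_holds` and the `C¹` Levi-Civita
connection `PseudoRiemannianMetric.isLocallyContMDiff_leviCivita_holds`). The instance hypothesis
`[Minkowski.DevelopmentFacts]` of the fact is uninhabited (`Minkowski.not_developmentFacts`); the
proof does not use this. [cite: Christodoulou1999, p. A27] [cite: arXiv08110354, §2.6.2] -/
theorem minkowski_hasCompleteFutureNullInfinity_holds : minkowski_hasCompleteFutureNullInfinity := by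
  unfold minkowski_hasCompleteFutureNullInfinity Development.HasCompleteFutureNullInfinity
  intro _inst
  -- the metric of the Minkowski development is `η = Minkowski.smoothMetric` (by `rfl`)
  haveI : Minkowski.smoothMetric.toPseudoRiemannianMetric.HasLeviCivita := _inst
  haveI : CovariantDerivative.ContMDiffCovariantDerivative
      Minkowski.smoothMetric.toPseudoRiemannianMetric.leviCivita 1 :=
    ⟨Minkowski.smoothMetric.toPseudoRiemannianMetric.isLocallyContMDiff_leviCivita_holds
      1 (by rw [show ((1 : ℕ∞) : ℕ∞ω) + 1 = 2 by norm_num]; exact WithTop.coe_le_coe.2 le_top)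
      univ isOpen_univ⟩
  change Minkowski.smoothMetric.HasCompleteFutureNullInfinity
    Minkowski.development.toDevelopment.timeOrientation Minkowski.sliceEmbed Minkowski.sliceNormal
  refine LorentzianMetric.hasCompleteFutureNullInfinity_of_isNullGeodesicallyComplete
    IsGeodesicOn.eqOn_of_velocity_eq_holds (fun x v _ ↦ ?_) _
  exact Minkowski.isGeodesicallyComplete_smoothMetric x v

end Discharge

end Literature.Geometry.Lorentzian
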